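import Mathlib.Analysis.Polynomial.Basic
import Mathlib.Analysis.SpecialFunctions.Log.Basic
import HarnessLib

/-!
# Power growth beats logarithmic growth: `|P(x) + μ log x| → ∞`

Topic `Literature/Analysis/Asymptotics`-style elementary fact, filed under
`Literature/Analysis/Complex` next to its use (growth of real parts of meromorphic germs along
rays versus logarithms of moduli). PROVED, no definition: for a real polynomial `P` and
`μ ≠ 0`, `|P(x) + μ log x| → ∞` as `x → +∞` (`tendsto_abs_eval_add_mul_log_atTop`): if
`deg P ≥ 1` the polynomial dominates (`log x = o(x)`), and if `P` is constant the logarithm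
diverges. In particular such an expression is NOT bounded along any sequence `xₙ → ∞`
(`not_bounded_eval_add_mul_log`). [folklore]
-/

noncomputable section

open Filter Topology Asymptotics Polynomial

namespace Literature.Analysis.Complex

namespace PolynomialLogGrowth

/-- `x ↦ μ log x` is negligible against `c xᵈ` at `+∞` for `d ≥ 1`, `c ≠ 0`. [folklore] -/
theorem isLittleO_mul_log_const_mul_pow (μ : ℝ) {c : ℝ} (hc : c ≠ 0) {d : ℕ} (hd : 0 < d) :
    (fun x : ℝ => μ * Real.log x) =o[atTop] fun x => c * x ^ d := by
  have h1 : Real.log =o[atTop] (id : ℝ → ℝ) := Real.isLittleO_log_id_atTop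
  have h2 : (id : ℝ → ℝ) =O[atTop] fun x : ℝ => x ^ d := by
    refine IsBigO.of_bound 1 ?_
    filter_upwards [eventually_ge_atTop (1 : ℝ)] with x hx
    rw [id, one_mul, Real.norm_eq_abs, Real.norm_eq_abs, abs_of_pos (by linarith),
      abs_of_pos (by positivity)]
    calc x = x ^ 1 := (pow_one x).symm
      _ ≤ x ^ d := pow_le_pow_right₀ hx hd
  exact ((h1.trans_isBigO h2).const_mul_left μ).const_mul_right hc

/-- **`|P(x) + μ log x| → ∞` as `x → +∞`** for every real polynomial `P` and `μ ≠ 0`.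
[folklore] -/
theorem tendsto_abs_eval_add_mul_log_atTop (P : ℝ[X]) {μ : ℝ} (hμ : μ ≠ 0) :
    Tendsto (fun x : ℝ => |P.eval x + μ * Real.log x|) atTop atTop := by
  by_cases hdeg : P.degree ≤ 0
  · -- constant polynomial: the logarithm diverges
    rw [eq_C_of_degree_le_zero hdeg]
    simp only [eval_C]
    rcases lt_or_gt_of_ne hμ with hneg | hpos
    · have h : Tendsto (fun x : ℝ => P.coeff 0 + μ * Real.log x) atTop atBot := by
        refine tendsto_atBot_add_const_left _ _ ?_
        have : Tendsto (fun x : ℝ => -μ * Real.log x) atTop atTop :=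
          Real.tendsto_log_atTop.const_mul_atTop (by linarith)
        have := tendsto_neg_atTop_atBot.comp this
        refine this.congr fun x => ?_
        simp only [Function.comp_apply]; ring
      exact tendsto_abs_atBot_atTop.comp h
    · have h : Tendsto (fun x : ℝ => P.coeff 0 + μ * Real.log x) atTop atTop :=
        tendsto_atTop_add_const_left _ _ (Real.tendsto_log_atTop.const_mul_atTop hpos)
      exact tendsto_abs_atTop_atTop.comp h
  · -- positive degree: the polynomial dominates
    have hd : 0 < P.degree := not_le.1 hdeg
    have hnd : 0 < P.natDegree := natDegree_pos_iff_degree_pos.2 hd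
    have hlc : P.leadingCoeff ≠ 0 := leadingCoeff_ne_zero.2 (ne_zero_of_degree_gt hd)
    have hequiv : (fun x : ℝ => P.eval x + μ * Real.log x) ~[atTop]
        fun x => P.leadingCoeff * x ^ P.natDegree :=
      (isEquivalent_atTop_lead P).add_isLittleO (isLittleO_mul_log_const_mul_pow μ hlc hnd)
    rcases lt_or_gt_of_ne hlc with hneg | hpos
    · have hlead : Tendsto (fun x : ℝ => P.leadingCoeff * x ^ P.natDegree) atTop atBot := by
        have : Tendsto (fun x : ℝ => -P.leadingCoeff * x ^ P.natDegree) atTop atTop :=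
          tendsto_const_mul_pow_atTop hnd.ne' (by linarith)
        have := tendsto_neg_atTop_atBot.comp this
        refine this.congr fun x => ?_
        simp only [Function.comp_apply]; ring
      exact tendsto_abs_atBot_atTop.comp (hequiv.symm.tendsto_atBot hlead)
    · have hlead : Tendsto (fun x : ℝ => P.leadingCoeff * x ^ P.natDegree) atTop atTop :=
        tendsto_const_mul_pow_atTop hnd.ne' hpos
      exact tendsto_abs_atTop_atTop.comp (hequiv.symm.tendsto_atTop hlead)

/-- **No bounded subsequence.** For a real polynomial `P`, `μ ≠ 0` and a bound `B` there is
`X₀` with `B < |P(x) + μ log x|` for all `x ≥ X₀`. [folklore] -/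
theorem exists_forall_lt_abs_eval_add_mul_log (P : ℝ[X]) {μ : ℝ} (hμ : μ ≠ 0) (B : ℝ) :
    ∃ X₀ : ℝ, ∀ x, X₀ ≤ x → B < |P.eval x + μ * Real.log x| := by
  have h := (tendsto_abs_eval_add_mul_log_atTop P hμ).eventually (eventually_gt_atTop B)
  obtain ⟨X₀, hX₀⟩ := eventually_atTop.1 h
  exact ⟨X₀, hX₀⟩

/-- The same along `r → 0⁺` with `x = r⁻¹`: `B < |P(r⁻¹) - μ log r|` for `0 < r < δ`.
[folklore] -/
theorem exists_forall_lt_abs_eval_inv_sub_mul_log (P : ℝ[X]) {μ : ℝ} (hμ : μ ≠ 0) (B : ℝ) :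
    ∃ δ > 0, ∀ r : ℝ, 0 < r → r < δ → B < |P.eval r⁻¹ - μ * Real.log r| := by
  obtain ⟨X₀, hX₀⟩ := exists_forall_lt_abs_eval_add_mul_log P hμ B
  refine ⟨(max X₀ 1)⁻¹, by positivity, fun r hr hrδ => ?_⟩
  have hx : X₀ ≤ r⁻¹ := by
    have h1 : max X₀ 1 < r⁻¹ := by
      rwa [lt_inv_comm₀ (by positivity) hr]
    exact (le_max_left _ _).trans h1.le
  have := hX₀ r⁻¹ hx
  rwa [Real.log_inv, mul_neg, ← sub_eq_add_neg] at this

end PolynomialLogGrowth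

end Literature.Analysis.Complex

end
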